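/-
Copyright (c) 2026 the pub-hodgecm-mathlib formalisation cell (harness21).  Prover seat hodgecm-mathlib-K2Liu-p06 (g3): Track B «K2-LIT»,
hLiu418 = stmt-HodgeConjecture-24832, director req649 (S1) ∕ LEAD F0P6-plan (g11) deal of record 2026-09-04T05:23:13Z = organ Φ1 of ROAD Φ
(ruling «M-155l» §2; CENSUS-41 row Φ1): the CHARACTERS file (A); 2026-09-04.
-/
import Summits.HodgeConjecture.HodgeConjecture.Theorems.K2LiuSiegelUnipotentFourierDefs   -- ★ (D) `unipDeltaChar`, `fourierCoeffDelta`, `skewMatrices`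
import Summits.HodgeConjecture.HodgeConjecture.Theorems.K2LiuUnipotentCocompact          -- ★ chart, `skew_sub_conj`, `gramRA_*`, `gramRL_facts`
import Summits.HodgeConjecture.HodgeConjecture.Theorems.K2LiuUnipotentCoveringWeight     -- ★ `countable_unipDeltaRat`
import Literature.NumberTheory.Automorphic.AdeleAddCharGaloisInvariance                  -- ★ (G) `adeleAddChar_smul`, `adeleAddChar_eq_one_of_smul_eq_neg`
import Literature.NumberTheory.Automorphic.AdelicAdditiveCharacterDuality                -- ★ Tate duality `exists_eq_algebraMap_of_forall_adeleAddChar_mul_eq_one`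
import HarnessLib

/-!
# Crux `HLiu418`, ROAD Φ, organ Φ1 (A1): THE UNIPOTENT CHARACTERS `ψ_S` OF `N_Δ(𝔸)` — group law, rationality, the trace pairing
# (hermitian-type indices die, skew indices are INJECTIVE and SEPARATING)

Cell `hodgecm-mathlib`, crux item hLiu418 = `stmt-HodgeConjecture-24832`, route `HCCMUnconditional`; squad K2 ∕ K2Liu, LEAD F0P6-plan (g11 → g12), deal req649
(S1) (memo `F0/P6/F0P6-plan-g11/DEALS-req649-S1S2S3.v1.F0P6-plan-g11.md` §(S1)), prover K2Liu-p06 (g3).  THEOREMS ONLY (no `def`, no instance, no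
notation, no named-fact hypothesis, no `sorry`); lane `--supports stmt-HodgeConjecture-24832 --as helper` (count-neutral).

SETTING.  ★ D9 `K2Lit/SiegelDoubledUnipotent` (`unipDelta = N_Δ(𝔸)`, `unipDeltaRat = N_Δ(L⁺)`), ★ `K2LiuUnipotentChart` (the frame coordinate
`X(u) = (blk u)₁₂` is `T_𝔸`-skew: `T X + σ(X)ᵀ T = 0`, `σ = c ⊗ 1`, `T = gramR ⊗ 1`, and `X ↦ n(X)` is a continuous additive chart onto `N_Δ(𝔸)`),
★ (D) `K2LiuSiegelUnipotentFourierDefs` (`ψ_S(u) = unipDeltaChar S u = ψ_L(tr(S_𝔸 X(u)))`, `φ_S(h) = fourierCoeffDelta νN β S φ h`, index group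
`skewMatrices c T_L`), ★ (G) `AdeleAddCharGaloisInvariance` (`ψ_L(σ x) = ψ_L(x)`; `ψ_L` kills `σ x = −x`).

CONTENTS.
* §1 ABSTRACT TRACE PAIRING over a commutative ring `R` with `σ : R →+* R`, `T` invertible: for `T`-skew `S` and ANY `Y`,
  **`trace_mul_skewProj`**: `tr(S · P(Y)) = tr(S Y) + σ(tr(S Y))`, `P(Y) = Y − T⁻¹ σ(Y)ᵀ T` the skew projection of ★ `K2LiuUnipotentCocompact`;
  for `T`-HERMITIAN-type `S` (`T S = σ(S)ᵀ T`) and `T`-skew `X`, **`map_trace_mul_eq_neg`**: `σ(tr(S X)) = −tr(S X)`.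
* §2 GROUP LAW: `toBlocks₁₂_blk_mul` (`X(uv) = X(u) + X(v)` on `N_Δ(𝔸)`), `toBlocks₁₂_blk_one`; `unipDeltaChar_mul ∕ _one ∕ _inv`, `continuous_unipDeltaChar`.
* §3 RATIONALITY: `toBlocks₁₂_blk_eq_map_of_mem_ratH` (rational points have rational coordinates), **`unipDeltaChar_eq_one_of_mem_ratH`** (`ψ_S ≡ 1` on
  `H(L⁺)`, in particular on `N_Δ(L⁺)`).
* §4 THE INDEX GROUP: **`unipDeltaChar_eq_one_of_herm`** (hermitian-type `S` give the trivial character of `N_Δ(𝔸)` — ★ (G)), so only `T_L`-skew indices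
  matter; **`unipDeltaChar_sq_eq_of_skew`** (`ψ_S(n(P Y)) = ψ_L(tr(S_𝔸 Y))²`); INJECTIVITY **`eq_zero_of_forall_unipDeltaChar_eq_one`** (a skew rational `S`
  with `ψ_S ≡ 1` on `N_Δ(𝔸)` is `0`; ★ `adeleAddChar_ne_one`); SEPARATION **`exists_map_eq_of_forall_unipDeltaChar_eq_one`** (a `u ∈ N_Δ(𝔸)` killed by
  every skew rational `ψ_S` has RATIONAL coordinate `X(u) = X₀ ⊗ 1`; ★ Tate duality) — i.e. `skewMatrices c T_L` IS the Pontryagin dual of the compact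
  abelian group `N_Δ(L⁺)\N_Δ(𝔸)` (used by the EXPANSION file (B)).
The Fourier COEFFICIENTS in covering-weight currency (vanishing of `∫ β • ψ_S`, `β`-independence, equivariance, identity cell) are the sequel
`Theorems/K2LiuSiegelFourierCoeffDelta.lean` (A2); the EXPANSION is `Theorems/K2LiuSiegelFourierExpansionDelta.lean` (B).
[MoeglinWaldspurger1995, I.2.6], [Shimura1997, §18.1], [Tan1999, §3], [KudlaRallis1994, §2], [Tate1950, §4.1 (duality `L^⊥ = L`)].

HONEST LABEL.  Count-neutral helper; `HC_CM` is proved only modulo the 7 printed citations (2 remaining named inputs: hLiu418 = `stmt-HodgeConjecture-24832`,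
h413 = `stmt-HodgeConjecture-24833`) until rung 0 closes.
-/

set_option autoImplicit false
set_option linter.dupNamespace false -- the mandated namespace repeats `HodgeConjecture.HodgeConjecture`

noncomputable section

open scoped Matrix ComplexConjugate
open NumberField IsDedekindDomain MeasureTheory MeasureTheory.Measure Filter Set Function
open Literature.NumberTheory.Automorphic Literature.NumberTheory.Automorphic.UnitaryGroup Literature.NumberTheory.GaloisRepresentations
open Literature.NumberTheory.GelbartRogawski1991 Literature.NumberTheory.GelbartRogawski1991.GRConstruction
open Literature.NumberTheory.K2Lit.SiegelDoubled

namespace Summit.HodgeConjecture.HodgeConjecture.Cruxes.HLiu418.K2LiuSiegelUnipotentCharacters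

open K2LiuSiegelUnipotentFourierDefs K2LiuUnipotentChart K2LiuUnipotentCocompact K2LiuSiegelDoubledLeviMatrix K2LiuSiegelDoubledRationalPoints
  K2LiuUnipotentCoveringWeight
open Literature.NumberTheory.Automorphic.DoubledUnitary.RankOneReduction (mem_range_toAdelic_iff)

/-! ## §1 The trace pairing over an abstract ring -/

section TracePairing

variable {R : Type*} [CommRing R] {ι : Type*} [Fintype ι] [DecidableEq ι] (σ : R →+* R) {T : Matrix ι ι R}

omit [DecidableEq ι] in
/-- a ring homomorphism commutes with the trace: `f(tr M) = tr(f(M))`. [folklore] -/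
theorem ringHom_map_trace {R' : Type*} [CommRing R'] (f : R →+* R') (M : Matrix ι ι R) : f M.trace = (M.map f).trace := by
  rw [Matrix.trace, Matrix.trace, _root_.map_sum]
  rfl

omit [DecidableEq ι] in
/-- `tr(σ(S)ᵀ σ(Y)ᵀ) = σ(tr(S Y))`. [folklore] -/
theorem trace_transpose_map_mul_transpose_map (S Y : Matrix ι ι R) : ((S.map σ)ᵀ * (Y.map σ)ᵀ).trace = σ (S * Y).trace := by
  rw [← Matrix.transpose_mul, Matrix.trace_transpose, ← Matrix.map_mul, ← ringHom_map_trace, Matrix.trace_mul_comm]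

/-- **The skew projection is adjoint to `1 + σ` under the trace pairing**: for a `T`-skew `S` (`T S + σ(S)ᵀ T = 0`, `T` invertible) and any `Y`,
`tr(S · (Y − T⁻¹ σ(Y)ᵀ T)) = tr(S Y) + σ(tr(S Y))`. [cite: Shimura1997, §18.1] [cite: MoeglinWaldspurger1995, I.2.6] -/
theorem trace_mul_skewProj (hT : IsUnit T.det) {S : Matrix ι ι R} (hS : T * S + (S.map σ)ᵀ * T = 0) (Y : Matrix ι ι R) :
    (S * (Y - T⁻¹ * (Y.map σ)ᵀ * T)).trace = (S * Y).trace + σ (S * Y).trace := by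
  have hS' : T * S = -((S.map σ)ᵀ * T) := eq_neg_of_add_eq_zero_left hS
  have h1 : (S * (T⁻¹ * (Y.map σ)ᵀ * T)).trace = -σ (S * Y).trace := by
    rw [show S * (T⁻¹ * (Y.map σ)ᵀ * T) = S * T⁻¹ * (Y.map σ)ᵀ * T by simp only [Matrix.mul_assoc], Matrix.trace_mul_comm,
      show T * (S * T⁻¹ * (Y.map σ)ᵀ) = T * S * T⁻¹ * (Y.map σ)ᵀ by simp only [Matrix.mul_assoc], hS', Matrix.neg_mul, Matrix.neg_mul,
      Matrix.mul_nonsing_inv_cancel_right T _ hT, Matrix.trace_neg, trace_transpose_map_mul_transpose_map]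
  rw [Matrix.mul_sub, Matrix.trace_sub, h1, sub_neg_eq_add]

/-- **Hermitian-type indices pair anti-symmetrically with skew coordinates**: if `T S = σ(S)ᵀ T` and `T X + σ(X)ᵀ T = 0` (`T` invertible) then
`σ(tr(S X)) = −tr(S X)`. [cite: Shimura1997, §18.1] [cite: MoeglinWaldspurger1995, I.2.6] -/
theorem map_trace_mul_eq_neg (hT : IsUnit T.det) {S : Matrix ι ι R} (hS : T * S = (S.map σ)ᵀ * T) {X : Matrix ι ι R}
    (hX : T * X + (X.map σ)ᵀ * T = 0) : σ (S * X).trace = -(S * X).trace := by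
  have hX' : (X.map σ)ᵀ = -(T * X * T⁻¹) := by
    have h := eq_neg_of_add_eq_zero_right hX
    rw [← Matrix.mul_nonsing_inv_cancel_right T (X.map σ)ᵀ hT, h, Matrix.neg_mul]
  have hS'' : (S.map σ)ᵀ = T * S * T⁻¹ := by
    rw [← Matrix.mul_nonsing_inv_cancel_right T (S.map σ)ᵀ hT, ← hS]
  rw [ringHom_map_trace, Matrix.map_mul, ← Matrix.trace_transpose, Matrix.transpose_mul, hX', hS'', Matrix.neg_mul, Matrix.trace_neg,
    show T * X * T⁻¹ * (T * S * T⁻¹) = T * (X * (T⁻¹ * T) * S * T⁻¹) by simp only [Matrix.mul_assoc], Matrix.nonsing_inv_mul T hT, Matrix.mul_one,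
    Matrix.trace_mul_comm, show X * S * T⁻¹ * T = X * S * (T⁻¹ * T) by simp only [Matrix.mul_assoc], Matrix.nonsing_inv_mul T hT, Matrix.mul_one,
    Matrix.trace_mul_comm]

/-- the trace pairing with a single-entry matrix picks out one entry: `tr(S · single j i a) = S i j · a`. [folklore] -/
theorem trace_mul_single (S : Matrix ι ι R) (i j : ι) (a : R) : (S * Matrix.single j i a).trace = S i j * a := by
  rw [Matrix.trace_mul_comm]
  simp only [Matrix.trace, Matrix.diag_apply]
  rw [Finset.sum_eq_single j]
  · simp only [Matrix.single_mul_apply_same]; ring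
  · intro k _ hk; simp only [Matrix.single_mul_apply_of_ne (h := hk)]
  · intro h; exact absurd (Finset.mem_univ j) h

end TracePairing

variable (L : Type) [Field L] [NumberField L] [IsCMField L]
variable {N M n : ℕ} (e : Fin N × Fin M ≃ Fin n)
  (dV : Fin N → L) (hdV : ∀ i, IsCMField.complexConj L (dV i) = dV i)
  (dW : Fin M → L) (hdW : ∀ i, IsCMField.complexConj L (dW i) = dW i)

/-! ## §2 The group law of the coordinate and of the characters -/

/-- **The frame coordinate is additive on `N_Δ(𝔸)`**: `X(uv) = X(u) + X(v)` (`n(X)n(Y) = n(X+Y)`). [cite: MoeglinWaldspurger1995, I.2.1]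
[cite: Shimura1997, §18.1] -/
theorem toBlocks₁₂_blk_mul {u v : HA L e dV hdV dW hdW} (hu : u ∈ unipDelta L e dV hdV dW hdW) (hv : v ∈ unipDelta L e dV hdV dW hdW) :
    (blk L e dV hdV dW hdW (u * v)).toBlocks₁₂ = (blk L e dV hdV dW hdW u).toBlocks₁₂ + (blk L e dV hdV dW hdW v).toBlocks₁₂ := by
  have h := conj_blk_mul L e dV hdV dW hdW u v
  rw [(mem_unipDelta_iff_conj L e dV hdV dW hdW _).1 (mul_mem hu hv), (mem_unipDelta_iff_conj L e dV hdV dW hdW u).1 hu,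
    (mem_unipDelta_iff_conj L e dV hdV dW hdW v).1 hv, fromBlocks_unip_mul] at h
  have h12 := congrArg Matrix.toBlocks₁₂ h
  rw [Matrix.toBlocks_fromBlocks₁₂, Matrix.toBlocks_fromBlocks₁₂] at h12
  rw [h12, add_comm]

/-- `X(1) = 0`. [cite: MoeglinWaldspurger1995, I.2.1] -/
theorem toBlocks₁₂_blk_one : (blk L e dV hdV dW hdW 1).toBlocks₁₂ = 0 := by
  rw [blk_one]
  ext i j
  rw [Matrix.toBlocks₁₂, Matrix.of_apply, Matrix.one_apply_ne (by simp), Matrix.zero_apply]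

/-- `X(u⁻¹) = −X(u)` on `N_Δ(𝔸)`. [cite: MoeglinWaldspurger1995, I.2.1] -/
theorem toBlocks₁₂_blk_inv {u : HA L e dV hdV dW hdW} (hu : u ∈ unipDelta L e dV hdV dW hdW) :
    (blk L e dV hdV dW hdW u⁻¹).toBlocks₁₂ = -(blk L e dV hdV dW hdW u).toBlocks₁₂ := by
  have h := toBlocks₁₂_blk_mul L e dV hdV dW hdW (inv_mem hu) hu
  rw [inv_mul_cancel, toBlocks₁₂_blk_one] at h
  exact eq_neg_of_add_eq_zero_left h.symm

/-- **`ψ_S` is multiplicative on `N_Δ(𝔸)`**: `ψ_S(uv) = ψ_S(u) ψ_S(v)`. [cite: Shimura1997, §18.1] [cite: MoeglinWaldspurger1995, I.2.6] -/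
theorem unipDeltaChar_mul (S : Matrix (Fin n) (Fin n) L) {u v : HA L e dV hdV dW hdW} (hu : u ∈ unipDelta L e dV hdV dW hdW)
    (hv : v ∈ unipDelta L e dV hdV dW hdW) :
    unipDeltaChar L e dV hdV dW hdW S (u * v) = unipDeltaChar L e dV hdV dW hdW S u * unipDeltaChar L e dV hdV dW hdW S v := by
  rw [unipDeltaChar_apply, unipDeltaChar_apply, unipDeltaChar_apply, toBlocks₁₂_blk_mul L e dV hdV dW hdW hu hv, Matrix.mul_add, Matrix.trace_add,
    AddChar.map_add_eq_mul]

/-- `ψ_S(1) = 1`. [cite: Shimura1997, §18.1] -/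
theorem unipDeltaChar_one (S : Matrix (Fin n) (Fin n) L) : unipDeltaChar L e dV hdV dW hdW S 1 = 1 := by
  rw [unipDeltaChar_apply, toBlocks₁₂_blk_one, Matrix.mul_zero, Matrix.trace_zero, AddChar.map_zero_eq_one]

/-- `ψ_S(u⁻¹) = ψ_S(u)⁻¹` on `N_Δ(𝔸)`. [cite: Shimura1997, §18.1] -/
theorem unipDeltaChar_inv (S : Matrix (Fin n) (Fin n) L) {u : HA L e dV hdV dW hdW} (hu : u ∈ unipDelta L e dV hdV dW hdW) :
    unipDeltaChar L e dV hdV dW hdW S u⁻¹ = (unipDeltaChar L e dV hdV dW hdW S u)⁻¹ := by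
  rw [unipDeltaChar_apply, unipDeltaChar_apply, toBlocks₁₂_blk_inv L e dV hdV dW hdW hu, Matrix.mul_neg, Matrix.trace_neg, AddChar.map_neg_eq_inv]

/-- `u ↦ X(u)` is continuous on `H(𝔸)`. [folklore] -/
theorem continuous_toBlocks₁₂_blk : Continuous fun u : HA L e dV hdV dW hdW => (blk L e dV hdV dW hdW u).toBlocks₁₂ := by
  have h1 : Continuous fun u : HA L e dV hdV dW hdW =>
      ((u : GL (Fin (n + n)) (AdeleRing (𝓞 L) L)) : Matrix (Fin (n + n)) (Fin (n + n)) (AdeleRing (𝓞 L) L)) :=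
    Units.continuous_val.comp continuous_subtype_val
  exact (h1.matrix_submatrix _ _).matrix_submatrix Sum.inl Sum.inr

/-- **`ψ_S` is continuous** (as a `ℂ`-valued function on `H(𝔸)`). [cite: MoeglinWaldspurger1995, I.2.6] -/
theorem continuous_unipDeltaChar (S : Matrix (Fin n) (Fin n) L) : Continuous fun u : HA L e dV hdV dW hdW => (unipDeltaChar L e dV hdV dW hdW S u : ℂ) := by
  refine continuous_subtype_val.comp ((continuous_adeleAddChar L).comp ?_)
  have h2 : Continuous fun u : HA L e dV hdV dW hdW => S.map (algebraMap L (AdeleRing (𝓞 L) L)) * (blk L e dV hdV dW hdW u).toBlocks₁₂ :=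
    continuous_const.matrix_mul (continuous_toBlocks₁₂_blk L e dV hdV dW hdW)
  show Continuous fun u : HA L e dV hdV dW hdW => ∑ i, Matrix.diag (S.map (algebraMap L (AdeleRing (𝓞 L) L)) * (blk L e dV hdV dW hdW u).toBlocks₁₂) i
  exact continuous_finsetSum _ fun i _ => (continuous_apply i).comp ((continuous_apply i).comp h2)

/-- `ψ_S` restricted to `N_Δ(𝔸)` is continuous. [cite: MoeglinWaldspurger1995, I.2.6] -/
theorem continuous_unipDeltaChar_coe (S : Matrix (Fin n) (Fin n) L) :
    Continuous fun u : unipDelta L e dV hdV dW hdW => (unipDeltaChar L e dV hdV dW hdW S (u : HA L e dV hdV dW hdW) : ℂ) :=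
  (continuous_unipDeltaChar L e dV hdV dW hdW S).comp continuous_subtype_val

/-! ## §3 Rationality -/

/-- **Rational points have rational coordinates**: for `γ ∈ H(L⁺)`, `X(γ) = X₀ ⊗ 1` for some `X₀ ∈ M_n(L)`. [cite: MoeglinWaldspurger1995, I.2.1] -/
theorem exists_toBlocks₁₂_blk_eq_map_of_mem_ratH {γ : HA L e dV hdV dW hdW} (hγ : γ ∈ ratH L e dV hdV dW hdW) :
    ∃ X₀ : Matrix (Fin n) (Fin n) L, (blk L e dV hdV dW hdW γ).toBlocks₁₂ = X₀.map (algebraMap L (AdeleRing (𝓞 L) L)) := by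
  obtain ⟨g, hg⟩ := (mem_range_toAdelic_iff (Fp L) L (IsCMField.complexConj L) (hermD L e dV hdV dW hdW) γ).1 hγ
  refine ⟨(Matrix.reindex (e₂ (n := n)).symm (e₂ (n := n)).symm (g : Matrix (Fin (n + n)) (Fin (n + n)) L)).toBlocks₁₂, ?_⟩
  have h1 : ((γ : GL (Fin (n + n)) (AdeleRing (𝓞 L) L)) : Matrix (Fin (n + n)) (Fin (n + n)) (AdeleRing (𝓞 L) L)) =
      (g : Matrix (Fin (n + n)) (Fin (n + n)) L).map (algebraMap L (AdeleRing (𝓞 L) L)) := by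
    rw [← hg]; rfl
  ext i j
  simp only [Matrix.toBlocks₁₂, Matrix.of_apply, Matrix.map_apply, Matrix.reindex_apply, Matrix.submatrix_apply, h1]

/-- **`ψ_S` is trivial on the rational points `H(L⁺)`** (so on `N_Δ(L⁺)`): `tr(S X₀) ∈ L` and `ψ_L(L) = 1` (★ `adeleAddChar_algebraMap`).
[cite: MoeglinWaldspurger1995, I.2.6] [cite: Shimura1997, §18.1] -/
theorem unipDeltaChar_eq_one_of_mem_ratH (S : Matrix (Fin n) (Fin n) L) {γ : HA L e dV hdV dW hdW} (hγ : γ ∈ ratH L e dV hdV dW hdW) :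
    unipDeltaChar L e dV hdV dW hdW S γ = 1 := by
  obtain ⟨X₀, hX₀⟩ := exists_toBlocks₁₂_blk_eq_map_of_mem_ratH L e dV hdV dW hdW hγ
  rw [unipDeltaChar_apply, hX₀, ← Matrix.map_mul, ← ringHom_map_trace, adeleAddChar_algebraMap]

/-- `ψ_S(γ u) = ψ_S(u)` for `γ ∈ N_Δ(L⁺)`, `u ∈ N_Δ(𝔸)`. [cite: MoeglinWaldspurger1995, I.2.6] -/
theorem unipDeltaChar_rat_mul (S : Matrix (Fin n) (Fin n) L) (γ : unipDeltaRat L e dV hdV dW hdW) (u : unipDelta L e dV hdV dW hdW) :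
    unipDeltaChar L e dV hdV dW hdW S (((γ : unipDelta L e dV hdV dW hdW) * u : unipDelta L e dV hdV dW hdW) : HA L e dV hdV dW hdW) =
      unipDeltaChar L e dV hdV dW hdW S (u : HA L e dV hdV dW hdW) := by
  rw [Subgroup.coe_mul, unipDeltaChar_mul L e dV hdV dW hdW S (γ : unipDelta L e dV hdV dW hdW).2 u.2,
    unipDeltaChar_eq_one_of_mem_ratH L e dV hdV dW hdW S ((mem_unipDeltaRat_iff L e dV hdV dW hdW _).1 γ.2), one_mul]

/-! ## §4 The index group: hermitian-type indices die; skew indices are injective and separating -/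

/-- `algebraMap L 𝔸_L` intertwines `c` and `σ = c ⊗ 1`. [folklore] -/
theorem algebraMap_complexConj (x : L) :
    algebraMap L (AdeleRing (𝓞 L) L) (((IsCMField.complexConj L : L ≃ₐ[Fp L] L) : L →+* L) x) =
      conjAdele (Fp L) L (IsCMField.complexConj L) (algebraMap L (AdeleRing (𝓞 L) L) x) :=
  algebraMap_conj (Fp L) L _ x

/-- **Hermitian-type indices give the trivial character of `N_Δ(𝔸)`**: if `T_L S = c(S)ᵀ T_L` (`T_L = gramR ⊗ L`) then `ψ_S(u) = 1` for every `u ∈ N_Δ(𝔸)`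
(`σ(tr(S X(u))) = −tr(S X(u))` by §1 and `ψ_L` kills anti-invariant adeles, ★ (G)).  Hence the Fourier expansion along `N_Δ` is indexed by
`M_n(L) ⧸ {hermitian-type} ≅ skewMatrices c T_L` (`≅ Herm_n(L)`). [cite: Shimura1997, §18.1] [cite: MoeglinWaldspurger1995, I.2.6] -/
theorem unipDeltaChar_eq_one_of_herm (hdV0 : ∀ i, dV i ≠ 0) (hdW0 : ∀ i, dW i ≠ 0) {S : Matrix (Fin n) (Fin n) L}
    (hS : (gramR L e dV hdV dW hdW).map (algebraMap (Fp L) L) * S =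
      (S.map ((IsCMField.complexConj L : L ≃ₐ[Fp L] L) : L →+* L))ᵀ * (gramR L e dV hdV dW hdW).map (algebraMap (Fp L) L))
    {u : HA L e dV hdV dW hdW} (hu : u ∈ unipDelta L e dV hdV dW hdW) : unipDeltaChar L e dV hdV dW hdW S u = 1 := by
  obtain ⟨-, -, -, hTLmap⟩ := gramRL_facts L e dV hdV dW hdW hdV0 hdW0
  have hTu := isUnit_det_gramRA L e dV hdV dW hdW hdV0 hdW0
  -- transport the hermitian condition to `𝔸_L`
  have hSA : (gramR L e dV hdV dW hdW).map ((algebraMap L (AdeleRing (𝓞 L) L)).comp (algebraMap (Fp L) L)) * S.map (algebraMap L (AdeleRing (𝓞 L) L)) =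
      ((S.map (algebraMap L (AdeleRing (𝓞 L) L))).map (conjAdele (Fp L) L (IsCMField.complexConj L)))ᵀ *
        (gramR L e dV hdV dW hdW).map ((algebraMap L (AdeleRing (𝓞 L) L)).comp (algebraMap (Fp L) L)) := by
    have h := congrArg (fun M : Matrix (Fin n) (Fin n) L => M.map (algebraMap L (AdeleRing (𝓞 L) L))) hS
    rw [Matrix.map_mul, Matrix.map_mul, hTLmap, map_cstar (algebraMap L (AdeleRing (𝓞 L) L)) (algebraMap_complexConj L)] at h
    exact h
  have hX := skew_of_mem_unipDelta L e dV hdV dW hdW hu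
  have key := map_trace_mul_eq_neg (conjAdele (Fp L) L (IsCMField.complexConj L)) hTu hSA hX
  rw [unipDeltaChar_apply]
  exact adeleAddChar_eq_one_of_smul_eq_neg (Fp L) (IsCMField.complexConj L) key

/-- **The square law**: for a `T_L`-skew rational `S`, every `Y ∈ M_n(𝔸_L)` and every `u ∈ N_Δ(𝔸)` with coordinate the skew projection
`X(u) = P(Y) = Y − T⁻¹σ(Y)ᵀT`, `ψ_S(u) = ψ_L(tr(S_𝔸 Y))²` (§1 + ★ (G) `adeleAddChar_add_smul`). [cite: Shimura1997, §18.1] -/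
theorem unipDeltaChar_eq_sq_of_skew (hdV0 : ∀ i, dV i ≠ 0) (hdW0 : ∀ i, dW i ≠ 0) {S : Matrix (Fin n) (Fin n) L}
    (hS : S ∈ skewMatrices ((IsCMField.complexConj L : L ≃ₐ[Fp L] L) : L →+* L) ((gramR L e dV hdV dW hdW).map (algebraMap (Fp L) L)))
    (Y : Matrix (Fin n) (Fin n) (AdeleRing (𝓞 L) L)) {u : HA L e dV hdV dW hdW}
    (hu : (blk L e dV hdV dW hdW u).toBlocks₁₂ =
      Y - ((gramR L e dV hdV dW hdW).map ((algebraMap L (AdeleRing (𝓞 L) L)).comp (algebraMap (Fp L) L)))⁻¹ *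
        (Y.map (conjAdele (Fp L) L (IsCMField.complexConj L)))ᵀ * (gramR L e dV hdV dW hdW).map ((algebraMap L (AdeleRing (𝓞 L) L)).comp (algebraMap (Fp L) L))) :
    unipDeltaChar L e dV hdV dW hdW S u = adeleAddChar L (S.map (algebraMap L (AdeleRing (𝓞 L) L)) * Y).trace ^ 2 := by
  obtain ⟨-, -, -, hTLmap⟩ := gramRL_facts L e dV hdV dW hdW hdV0 hdW0
  have hTu := isUnit_det_gramRA L e dV hdV dW hdW hdV0 hdW0
  have hSA : S.map (algebraMap L (AdeleRing (𝓞 L) L)) ∈ skewMatrices (conjAdele (Fp L) L (IsCMField.complexConj L))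
      ((gramR L e dV hdV dW hdW).map ((algebraMap L (AdeleRing (𝓞 L) L)).comp (algebraMap (Fp L) L))) := by
    rw [← hTLmap]
    exact map_mem_skewMatrices (algebraMap L (AdeleRing (𝓞 L) L)) (algebraMap_complexConj L) hS
  rw [unipDeltaChar_apply, hu, trace_mul_skewProj _ hTu hSA Y, conjAdele_apply, adeleAddChar_add_smul (Fp L)]

/-- **INJECTIVITY of the skew character family**: a `T_L`-skew rational `S` with `ψ_S ≡ 1` on `N_Δ(𝔸)` is `0`.  (Square law with `Y` and `Y/2`:
`ψ_L(tr(S_𝔸 Y)) = 1` for ALL `Y ∈ M_n(𝔸_L)`; single-entry `Y` and ★ `adeleAddChar_ne_one` give `S_{ij} = 0`.) [cite: Tan1999, §3]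
[cite: Shimura1997, §18.1] [cite: MoeglinWaldspurger1995, I.2.6] -/
theorem eq_zero_of_forall_unipDeltaChar_eq_one (hdV0 : ∀ i, dV i ≠ 0) (hdW0 : ∀ i, dW i ≠ 0) {S : Matrix (Fin n) (Fin n) L}
    (hS : S ∈ skewMatrices ((IsCMField.complexConj L : L ≃ₐ[Fp L] L) : L →+* L) ((gramR L e dV hdV dW hdW).map (algebraMap (Fp L) L)))
    (h1 : ∀ u : HA L e dV hdV dW hdW, u ∈ unipDelta L e dV hdV dW hdW → unipDeltaChar L e dV hdV dW hdW S u = 1) : S = 0 := by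
  classical
  have hTu := isUnit_det_gramRA L e dV hdV dW hdW hdV0 hdW0
  have hTσ := gramRA_map_conjAdele L e dV hdV dW hdW
  have hTt := gramRA_transpose L e dV hdV dW hdW
  have hσσ : ∀ x, conjAdele (Fp L) L (IsCMField.complexConj L) (conjAdele (Fp L) L (IsCMField.complexConj L) x) = x := conjAdele_conjAdele' L
  obtain ⟨φ, -, -, hφmem, -, -⟩ := exists_unipChart L e dV hdV dW hdW
  -- every `Y` gives an element `n(P Y)` of `N_Δ(𝔸)`, on which `ψ_S` is `ψ_L(tr(S_𝔸 Y))²`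
  have hsq : ∀ Y : Matrix (Fin n) (Fin n) (AdeleRing (𝓞 L) L), adeleAddChar L (S.map (algebraMap L (AdeleRing (𝓞 L) L)) * Y).trace ^ 2 = 1 := by
    intro Y
    obtain ⟨hYHA, hYN, hYframe⟩ := hφmem _ (skew_sub_conj (conjAdele (Fp L) L (IsCMField.complexConj L)) hTu hTσ hTt hσσ Y)
    have hcoord : (blk L e dV hdV dW hdW ⟨φ (Y - ((gramR L e dV hdV dW hdW).map ((algebraMap L (AdeleRing (𝓞 L) L)).comp (algebraMap (Fp L) L)))⁻¹ *
        (Y.map (conjAdele (Fp L) L (IsCMField.complexConj L)))ᵀ * (gramR L e dV hdV dW hdW).map ((algebraMap L (AdeleRing (𝓞 L) L)).comp (algebraMap (Fp L) L))),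
        hYHA⟩).toBlocks₁₂ =
        Y - ((gramR L e dV hdV dW hdW).map ((algebraMap L (AdeleRing (𝓞 L) L)).comp (algebraMap (Fp L) L)))⁻¹ *
          (Y.map (conjAdele (Fp L) L (IsCMField.complexConj L)))ᵀ * (gramR L e dV hdV dW hdW).map ((algebraMap L (AdeleRing (𝓞 L) L)).comp (algebraMap (Fp L) L)) := by
      have h := (mem_unipDelta_iff_conj L e dV hdV dW hdW _).1 hYN
      rw [hYframe] at h
      have h12 := congrArg Matrix.toBlocks₁₂ h
      rwa [Matrix.toBlocks_fromBlocks₁₂, Matrix.toBlocks_fromBlocks₁₂, eq_comm] at h12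
    rw [← unipDeltaChar_eq_sq_of_skew L e dV hdV dW hdW hdV0 hdW0 hS Y hcoord]
    exact h1 _ hYN
  -- halving: `ψ(t)² = 1` on an `𝔸_L`-submodule forces `ψ(t) = 1`
  have hone : ∀ Y : Matrix (Fin n) (Fin n) (AdeleRing (𝓞 L) L), adeleAddChar L (S.map (algebraMap L (AdeleRing (𝓞 L) L)) * Y).trace = 1 := by
    intro Y
    have h := hsq ((⅟ (2 : AdeleRing (𝓞 L) L)) • Y)
    rwa [Matrix.mul_smul, Matrix.trace_smul, smul_eq_mul, sq, ← AddChar.map_add_eq_mul, ← add_mul, invOf_two_add_invOf_two, one_mul] at h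
  -- single-entry `Y`: `ψ_L(S_ij a) = 1` for all `a`, hence `S_ij = 0`
  ext i j
  by_contra hij
  obtain ⟨x, hx⟩ := (isGlobalAddChar_adeleAddChar L).exists_apply_ne_one
  have h := hone (Matrix.single j i (algebraMap L (AdeleRing (𝓞 L) L) (S i j)⁻¹ * x))
  rw [trace_mul_single, Matrix.map_apply, ← mul_assoc, ← map_mul, mul_inv_cancel₀ hij, map_one, one_mul] at h
  exact hx h

/-- **SEPARATION by the skew character family**: if `u ∈ N_Δ(𝔸)` is killed by `ψ_S` for EVERY `T_L`-skew rational `S`, then its coordinate is rational,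
`X(u) = X₀ ⊗ 1` with `X₀` a `T_L`-skew rational matrix (so `u ∈ N_Δ(L⁺) · ` nothing: `u` is a rational unipotent point).  (Square law with the roles of
index and coordinate exchanged, halving, then Tate's duality `L^⊥ = L` entry by entry, ★ `exists_eq_algebraMap_of_forall_adeleAddChar_mul_eq_one`.)
[cite: Tate1950, §4.1 Thm. 4.1.4] [cite: MoeglinWaldspurger1995, I.2.6] [cite: Shimura1997, §18.1] -/
theorem exists_map_eq_of_forall_unipDeltaChar_eq_one (hdV0 : ∀ i, dV i ≠ 0) (hdW0 : ∀ i, dW i ≠ 0) {u : HA L e dV hdV dW hdW}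
    (hu : u ∈ unipDelta L e dV hdV dW hdW)
    (h1 : ∀ S ∈ skewMatrices ((IsCMField.complexConj L : L ≃ₐ[Fp L] L) : L →+* L) ((gramR L e dV hdV dW hdW).map (algebraMap (Fp L) L)),
      unipDeltaChar L e dV hdV dW hdW S u = 1) :
    ∃ X₀ ∈ skewMatrices ((IsCMField.complexConj L : L ≃ₐ[Fp L] L) : L →+* L) ((gramR L e dV hdV dW hdW).map (algebraMap (Fp L) L)),
      (blk L e dV hdV dW hdW u).toBlocks₁₂ = X₀.map (algebraMap L (AdeleRing (𝓞 L) L)) := by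
  classical
  obtain ⟨hTLu, hTLc, hTLt, hTLmap⟩ := gramRL_facts L e dV hdV dW hdW hdV0 hdW0
  have hTu := isUnit_det_gramRA L e dV hdV dW hdW hdV0 hdW0
  have hcc : ∀ x, ((IsCMField.complexConj L : L ≃ₐ[Fp L] L) : L →+* L) (((IsCMField.complexConj L : L ≃ₐ[Fp L] L) : L →+* L) x) = x :=
    fun x => IsCMField.complexConj_apply_apply L x
  have hX := skew_of_mem_unipDelta L e dV hdV dW hdW hu
  -- square law, roles exchanged: `ψ_L(tr(X · (Y₀ ⊗ 1)))² = 1` for every rational `Y₀`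
  have hsq : ∀ Y₀ : Matrix (Fin n) (Fin n) L,
      adeleAddChar L ((blk L e dV hdV dW hdW u).toBlocks₁₂ * Y₀.map (algebraMap L (AdeleRing (𝓞 L) L))).trace ^ 2 = 1 := by
    intro Y₀
    have hPskew := skew_sub_conj ((IsCMField.complexConj L : L ≃ₐ[Fp L] L) : L →+* L) hTLu hTLc hTLt hcc Y₀
    have h := h1 _ ((mem_skewMatrices_iff _ _ _).2 hPskew)
    have hmapP : ((Y₀ - ((gramR L e dV hdV dW hdW).map (algebraMap (Fp L) L))⁻¹ * (Y₀.map ((IsCMField.complexConj L : L ≃ₐ[Fp L] L) : L →+* L))ᵀ *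
        (gramR L e dV hdV dW hdW).map (algebraMap (Fp L) L))).map (algebraMap L (AdeleRing (𝓞 L) L)) =
        Y₀.map (algebraMap L (AdeleRing (𝓞 L) L)) -
          ((gramR L e dV hdV dW hdW).map ((algebraMap L (AdeleRing (𝓞 L) L)).comp (algebraMap (Fp L) L)))⁻¹ *
            ((Y₀.map (algebraMap L (AdeleRing (𝓞 L) L))).map (conjAdele (Fp L) L (IsCMField.complexConj L)))ᵀ *
          (gramR L e dV hdV dW hdW).map ((algebraMap L (AdeleRing (𝓞 L) L)).comp (algebraMap (Fp L) L)) := by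
      rw [Matrix.map_sub _ (map_sub _), Matrix.map_mul, Matrix.map_mul, map_nonsing_inv_of_isUnit _ hTLu, hTLmap,
        map_cstar (algebraMap L (AdeleRing (𝓞 L) L)) (algebraMap_complexConj L)]
    rw [unipDeltaChar_apply, hmapP, Matrix.trace_mul_comm, trace_mul_skewProj _ hTu hX, conjAdele_apply, adeleAddChar_add_smul (Fp L)] at h
    exact h
  -- entry by entry: `ψ_L(a X_ij) = 1` for all `a ∈ L` (halving inside), so `X_ij ∈ L` (Tate duality)
  have hentry : ∀ i j, ∃ x : L, (blk L e dV hdV dW hdW u).toBlocks₁₂ i j = algebraMap L (AdeleRing (𝓞 L) L) x := by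
    intro i j
    refine exists_eq_algebraMap_of_forall_adeleAddChar_mul_eq_one L fun a => ?_
    have h := hsq (Matrix.single j i (⅟ (2 : L) * a))
    rwa [Matrix.map_single, trace_mul_single, sq, ← AddChar.map_add_eq_mul, ← mul_add, ← map_add, ← add_mul, invOf_two_add_invOf_two, one_mul,
      mul_comm] at h
  choose x hx using hentry
  refine ⟨Matrix.of fun i j => x i j, ?_, ?_⟩
  · -- skewness descends along the injective `L → 𝔸_L`
    rw [mem_skewMatrices_iff]
    have hXmap : (blk L e dV hdV dW hdW u).toBlocks₁₂ = (Matrix.of fun i j => x i j).map (algebraMap L (AdeleRing (𝓞 L) L)) := by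
      ext i j; exact hx i j
    have hinj : Function.Injective (fun A : Matrix (Fin n) (Fin n) L => A.map (algebraMap L (AdeleRing (𝓞 L) L))) := by
      intro A B h
      ext i j
      exact AdeleRing.algebraMap_injective (𝓞 L) L (by simpa using congrFun (congrFun h i) j)
    apply hinj
    dsimp only
    rw [Matrix.map_add _ (map_add _), Matrix.map_mul, Matrix.map_mul, hTLmap, map_cstar (algebraMap L (AdeleRing (𝓞 L) L)) (algebraMap_complexConj L),
      ← hXmap, hX, Matrix.map_zero _ (map_zero _)]
  · ext i j; exact hx i j

end Summit.HodgeConjecture.HodgeConjecture.Cruxes.HLiu418.K2LiuSiegelUnipotentCharacters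

end
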